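/-
Copyright: the b2b-balaban cell (near-miss cell 7), T⁴-continuum fan-out; row NE7b ROUND-2 swarm, seat
t4-ne7b-formalise-leaf-04 (gen 3) — row S6g′(a), file 5 «THE LAW FOR PIECES» (journal CLAIM l.9299, located interface
point F-leaf04g3-1 l.9871).  Released under the licence of the surrounding project.
-/
import Summits.QuantumFields.BalabanUV.T4Continuum.Support.HistoryZoneMassPieces

/-!
# Zone mass for PIECES, II: the cardinality law at levels with linkedness assumed, and concluded, for PIECES only

Summits-side support leaf of the T⁴-continuum cell (rung (B)+1 on a FINITE torus only; NOT infinite volume, NOT the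
mass gap, NOT the Clay statement; NOT a proof of the spine estimate NE7b).  Row NE7b, route «COUNT», row S6g′
«MASS-BASED SIBLING COUNT» (R-OWNER-22-12 (2)), step (a): `HistoryZoneMassLawLevels.card_zone_le_levels` (this
lineage, p213501) RE-RUN over the slim reading `HistoryZoneMassPieces.ZoneStepsD` (no birth-diameter, no binary
contact) with the LINKED field displayed only for PIECES of `G` (`X ∈ HistoryZoneEvolve.parts sh t₀ G` for some cut
`t₀`: births, and mergers that are cluster tops hereditarily) and the bound concluded for pieces only — the form the
COUNT needs (F-leaf04g3-1: canonically admissible placements give forest contact among a join's parts, under which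
only PIECES have linked zones; `HistoryZoneMassCluster` discharges the linked field for the region reading from
exactly that).  The proof is the p213501 proof token for token, except that the ancestor decomposition is
`zone_subset_partsS` and the induction hypothesis ∕ linked field are invoked on pieces of pieces through
`parts_trans`.  [folklore] structural recursion + linear real arithmetic on OUR carriers; `zmass`∕`zmass_parts`∕
`length_parts_le`∕`recN_mul_le_recM`∕`mul_zmass_le` (p212899) and `card_evolveD_le`∕`sideD_add` (p213334) BY NAME;
nothing is quoted from print, nothing printed is asserted, no `[cite:]` tag, no `Prop`-valued fact minted; constants
SYMBOLIC (trigger c2∕c6), same currency as p212899∕p213501.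

THE LAW FOR PIECES (`card_zone_le_pieces`).  `L ≥ 1`, `LevelFn K lv`, `ZoneStepsD sh n L K lv c G zone`, chronology,
`hlink : ∀ t t₀ X, X ∈ parts sh t₀ G → ftime X ≤ t → t ≤ K → Linked (sideD n L K lv t) ρ (zone t X)` (`ρ ≥ 1`), `hbirth`
(`C₁ ≥ 0`), stride `s ≥ 1` with level advance `m` (`hm`) and `(2·cth c 1 s + 1)^d·5^d·ρ ≤ L^m∕2`, decay `0 ≤ θ ≤ 1` with
`θ^s ≥ 1∕2` ⇒ `∀ t t₀ X, X ∈ parts sh t₀ G → ftime X ≤ t → t ≤ K → #(zone t X) ≤ zmass sh θ (2A₁C₁) (4A) t X + 2A`,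
`A₁ = (2·cth c 1 s + 1)^d`, `A = A₁·5^d`; corollaries `card_zone_le_pieces_half` (`m := s∕2`) and
`card_zone_le_pieces_self` (for `G` itself when `G` is a birth or a merger: `G ∈ parts sh (ftime G + 1) G`).

HONEST: a law about OUR levelled reading; NE7b NOT proved; spine 0∕9.  HONEST DEPENDENCY (cell): continuum YM on T⁴
⇐ BetaPertH ∧ nine spine estimates (0/9 proved); BetaPertH ⇐ (D1) ∧ (D4) ∧ CAP+tail; G-an2-4 gates asym, D1 and
NE2/3/4.  This file changes none of it.
-/

open Finset
open Literature.MathematicalPhysics.QuantumFieldTheory.Balaban1983to89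
open T4PersistenceDictionary T4PartnerMultiplicity
open Summit.QuantumFields.BalabanUV.T4Continuum.PlacementSkeleton
open Summit.QuantumFields.BalabanUV.T4Continuum.Crowding
open Summit.QuantumFields.BalabanUV.T4Continuum.ZoneSkeleton
open Summit.QuantumFields.BalabanUV.T4Continuum.ZoneTorus
open Summit.QuantumFields.BalabanUV.T4Continuum.HistoryZones
open Summit.QuantumFields.BalabanUV.T4Continuum.HistoryZoneMass
open Summit.QuantumFields.BalabanUV.T4Continuum.HistoryZoneEvolve
open Summit.QuantumFields.BalabanUV.T4Continuum.HistoryZoneMassLaw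
open Summit.QuantumFields.BalabanUV.T4Continuum.HistoryZoneEvolveLevels
open Summit.QuantumFields.BalabanUV.T4Continuum.HistoryZoneMassLawLevels
open Summit.QuantumFields.BalabanUV.T4Continuum.HistoryZoneMassPieces

namespace Summit.QuantumFields.BalabanUV.T4Continuum.HistoryZoneMassPiecesLaw

noncomputable section

variable {d : ℕ}

/-! ## §1 The law for pieces -/

section Law

variable {ε : Type*} [DecidableEq ε] {sh : ε → PEv} {n L K c : ℕ} {lv : ℕ → ℕ} {G : Gen ε}
  {zone : ℕ → Gen ε → Finset (Fin d → ℕ)}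

/-- **THE CARDINALITY LAW AT LEVELS FOR PIECES** (row S6g′(a); linked field assumed and bound concluded for the pieces
of `G` only; slim reading). [folklore] -/
theorem card_zone_le_pieces (hL : 1 ≤ L) (hlv : LevelFn K lv) (hR : ZoneStepsD sh n L K lv c G zone)
    (hchr : Chrono (PEv.step ∘ sh) G) {ρ : ℕ} (hρ : 1 ≤ ρ)
    (hlink : ∀ (t t₀ : ℕ) (X : Gen ε), X ∈ parts sh t₀ G → ftime (PEv.step ∘ sh) X ≤ t → t ≤ K →
      Linked (sideD n L K lv t) ρ (zone t X))
    {C₁ : ℝ} (hC₁ : 0 ≤ C₁)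
    (hbirth : ∀ (b : ε) (j : ℕ), Sub (Gen.born b j) G →
      ((zone (sh b).step (Gen.born b j)).card : ℝ) ≤ C₁ * (((sh b).fat : ℝ) + 1))
    {s m : ℕ} (hs : 1 ≤ s) (hm : ∀ u : ℕ, u + s ≤ K → lv u + m ≤ lv (u + s))
    (hsmall : (((2 * cth c 1 s + 1) ^ d : ℕ) : ℝ) * (5 : ℝ) ^ d * ρ ≤ (L : ℝ) ^ m / 2)
    {θ : ℝ} (hθ0 : 0 ≤ θ) (hθ1 : θ ≤ 1) (hθs : 1 / 2 ≤ θ ^ s) :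
    ∀ (t tX : ℕ) (X : Gen ε), X ∈ parts sh tX G → ftime (PEv.step ∘ sh) X ≤ t → t ≤ K →
      ((zone t X).card : ℝ) ≤
        zmass sh θ (2 * (((2 * cth c 1 s + 1) ^ d : ℕ) : ℝ) * C₁)
            (4 * ((((2 * cth c 1 s + 1) ^ d : ℕ) : ℝ) * (5 : ℝ) ^ d)) t X +
          2 * ((((2 * cth c 1 s + 1) ^ d : ℕ) : ℝ) * (5 : ℝ) ^ d) := by
  -- names and signs of the constants
  set A₁ : ℝ := (((2 * cth c 1 s + 1) ^ d : ℕ) : ℝ) with hA₁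
  set A : ℝ := A₁ * (5 : ℝ) ^ d with hA
  set WB : ℝ := 2 * A₁ * C₁ with hWB
  set WM : ℝ := 4 * A with hWM
  have hA₁0 : 0 ≤ A₁ := by positivity
  have hA0 : 0 ≤ A := by positivity
  have hWB0 : 0 ≤ WB := by positivity
  have hWM0 : 0 ≤ WM := by positivity
  have hL0 : (0 : ℝ) < L := by exact_mod_cast hL
  have hL1 : (1 : ℝ) ≤ L := by exact_mod_cast hL
  have hLm : (0 : ℝ) < (L : ℝ) ^ m := by positivity
  have hρ0 : (0 : ℝ) ≤ ρ := by positivity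
  set a : ℝ := A * ρ / (L : ℝ) ^ m with ha
  have ha0 : 0 ≤ a := by positivity
  have hahalf : a ≤ 1 / 2 := by rw [ha, div_le_iff₀ hLm]; linarith
  have haθ : a ≤ θ ^ s := hahalf.trans hθs
  -- strong induction on `t`
  intro t
  induction t using Nat.strong_induction_on with
  | _ t ih =>
  intro tX X hXp hft htK
  have hX : Sub X G := Sub.trans (sub_of_mem_parts tX hXp) (Sub.refl G)
  set t₀ := t + 1 - s with ht₀
  have ht₀le : t₀ ≤ t + 1 := by omega
  have hdec := zone_subset_partsS hR hchr t₀ hX ht₀le hft htK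
  have hchrX := chrono_of_sub (PEv.step ∘ sh) hX hchr
  -- the cost of one piece
  have piece : ∀ p ∈ parts sh t₀ X,
      ((evolveD n L K lv c (ustart sh t₀ p) (t - ustart sh t₀ p) (zone (ustart sh t₀ p) p)).card : ℝ) ≤
        zmass sh θ WB WM t p + (2 * a * A + A) := by
    intro p hp
    have hpX := sub_of_mem_parts t₀ hp
    have hpG : Sub p G := Sub.trans hpX hX
    obtain ⟨t₂, hp₂⟩ := parts_trans hXp hp
    have hchrp := chrono_of_sub (PEv.step ∘ sh) hpX hchrX
    have hfp : ftime (PEv.step ∘ sh) p ≤ t := (ftime_le_of_sub _ hpX hchrX).trans hft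
    have hfu : ftime (PEv.step ∘ sh) p ≤ ustart sh t₀ p := le_max_right _ _
    have hut : ustart sh t₀ p ≤ t := max_le (by omega) hfp
    have huK : ustart sh t₀ p ≤ K := hut.trans htK
    have hRu : InRange (sideD n L K lv (ustart sh t₀ p)) (zone (ustart sh t₀ p) p) := hR.inRange _ p hpG
    have hukK : ustart sh t₀ p + (t - ustart sh t₀ p) ≤ K := by rw [Nat.add_sub_cancel' hut]; exact htK
    have hcard := card_evolveD_le (c := c) hL hlv (ustart sh t₀ p) hRu hukK
    rw [Nat.add_sub_cancel' hut] at hcard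
    have hks : t - ustart sh t₀ p ≤ s := by
      have : t₀ - 1 ≤ ustart sh t₀ p := le_max_left _ _
      omega
    have hcth : (((2 * cth c 1 (t - ustart sh t₀ p) + 1) ^ d : ℕ) : ℝ) ≤ A₁ := by
      rw [hA₁]
      have hmn := cth_mono c 1 hks
      exact_mod_cast Nat.pow_le_pow_left (by omega) d
    have h1 : ((evolveD n L K lv c (ustart sh t₀ p) (t - ustart sh t₀ p) (zone (ustart sh t₀ p) p)).card : ℝ) ≤
        A₁ * ((blocks (L ^ (lv t - lv (ustart sh t₀ p))) (zone (ustart sh t₀ p) p)).card : ℝ) :=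
      calc ((evolveD n L K lv c (ustart sh t₀ p) (t - ustart sh t₀ p) (zone (ustart sh t₀ p) p)).card : ℝ)
          ≤ (((2 * cth c 1 (t - ustart sh t₀ p) + 1) ^ d : ℕ) : ℝ) *
              ((blocks (L ^ (lv t - lv (ustart sh t₀ p))) (zone (ustart sh t₀ p) p)).card : ℝ) := by
            exact_mod_cast hcard
        _ ≤ A₁ * ((blocks (L ^ (lv t - lv (ustart sh t₀ p))) (zone (ustart sh t₀ p) p)).card : ℝ) :=
            mul_le_mul_of_nonneg_right hcth (Nat.cast_nonneg _)
    have hextra : 0 ≤ 2 * a * A + A := by positivity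
    rcases parts_cases t₀ hp with hold | ⟨b, j, rfl, hbt⟩
    · -- an ANCESTOR: start `u = t − s`, `s` steps, level advance `≥ m`; linked set meets few `L^{Δlv}`-blocks; the
      -- induction hypothesis at `u`
      have hueq : ustart sh t₀ p = t - s := by
        show max (t₀ - 1) (ftime (PEv.step ∘ sh) p) = t - s
        rw [max_eq_left (by omega)]; omega
      have hkeq : t - (t - s) = s := by omega
      rw [hueq] at h1 hRu hfu huK ⊢
      rw [hkeq] at h1 ⊢
      set u := t - s with hu
      have hult : u < t := by omega
      have hus : u + s ≤ K := by omega
      have hust : u + s = t := by omega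
      have ihp := ih u hult t₂ p hp₂ hfu huK
      have hlk := hlink u t₂ p hp₂ hfu huK
      have hΔ : m ≤ lv t - lv u := by have := hm u hus; rw [hust] at this; omega
      have hSe : sideD n L K lv u = sideD n L K lv t * L ^ (lv t - lv u) := by
        have := sideD_add (n := n) (L := L) hlv hus; rwa [hust] at this
      have hRu' : InRange (sideD n L K lv t * L ^ (lv t - lv u)) (zone u p) := by rw [← hSe]; exact hRu
      have hlk' : Linked (sideD n L K lv t * L ^ (lv t - lv u)) ρ (zone u p) := by rw [← hSe]; exact hlk
      have hbl := card_blocks_le_of_linked_real (Nat.one_le_pow _ _ hL) hρ hRu' hlk'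
      have hz0 : (0 : ℝ) ≤ (ρ : ℝ) * ((zone u p).card : ℝ) := by positivity
      have hpow : (L : ℝ) ^ m ≤ (L : ℝ) ^ (lv t - lv u) := pow_le_pow_right₀ hL1 hΔ
      have hdiv : (ρ : ℝ) * ((zone u p).card : ℝ) / (L : ℝ) ^ (lv t - lv u) ≤
          (ρ : ℝ) * ((zone u p).card : ℝ) / (L : ℝ) ^ m := div_le_div_of_nonneg_left hz0 hLm hpow
      have hbl' : ((blocks (L ^ (lv t - lv u)) (zone u p)).card : ℝ) ≤
          (5 : ℝ) ^ d * ((ρ : ℝ) * ((zone u p).card : ℝ) / (L : ℝ) ^ m + 1) := by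
        have h := hbl
        push_cast at h
        exact h.trans (mul_le_mul_of_nonneg_left (by linarith) (by positivity))
      have h2 : A₁ * ((blocks (L ^ (lv t - lv u)) (zone u p)).card : ℝ) ≤ a * ((zone u p).card : ℝ) + A := by
        have h := mul_le_mul_of_nonneg_left hbl' hA₁0
        have e : A₁ * ((5 : ℝ) ^ d * ((ρ : ℝ) * ((zone u p).card : ℝ) / (L : ℝ) ^ m + 1)) =
            a * ((zone u p).card : ℝ) + A := by
          rw [ha, hA]; ring
        linarith
      have h3 : a * ((zone u p).card : ℝ) ≤ a * (zmass sh θ WB WM u p + 2 * A) := mul_le_mul_of_nonneg_left ihp ha0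
      have h4 : a * zmass sh θ WB WM u p ≤ zmass sh θ WB WM t p := by
        have h := mul_zmass_le (sh := sh) hθ0 hWB0 hWM0 ha0 haθ hchrp hfu (k := s)
        rwa [hust] at h
      linarith
    · -- a RECENT BIRTH: start `u = st b`, age `≤ s − 1`; `#blocks ≤ #zone (st b) ≤ C₁·(fat+1)`
      have hueq : ustart sh t₀ (Gen.born b j) = (sh b).step := by
        show max (t₀ - 1) (sh b).step = (sh b).step
        exact max_eq_right (by omega)
      rw [hueq] at h1 ⊢
      set k := t - (sh b).step with hk
      have hks' : k ≤ s - 1 := by omega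
      have hbl : ((blocks (L ^ (lv t - lv (sh b).step)) (zone (sh b).step (Gen.born b j))).card : ℝ) ≤
          C₁ * (((sh b).fat : ℝ) + 1) :=
        le_trans (by exact_mod_cast card_image_le) (hbirth b j hpG)
      have h2 : ((evolveD n L K lv c (sh b).step k (zone (sh b).step (Gen.born b j))).card : ℝ) ≤
          A₁ * (C₁ * (((sh b).fat : ℝ) + 1)) := h1.trans (mul_le_mul_of_nonneg_left hbl hA₁0)
      have hpow : 1 / 2 ≤ θ ^ k := hθs.trans (pow_le_pow_of_le_one hθ0 hθ1 (by omega))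
      have hz : zmass sh θ WB WM t (Gen.born b j) = WB * (((sh b).fat : ℝ) + 1) * θ ^ k := rfl
      rw [hz, hWB]
      have hf0 : 0 ≤ A₁ * (C₁ * (((sh b).fat : ℝ) + 1)) := by positivity
      have hcore : A₁ * (C₁ * (((sh b).fat : ℝ) + 1)) ≤ 2 * A₁ * C₁ * (((sh b).fat : ℝ) + 1) * θ ^ k := by
        nlinarith [mul_le_mul_of_nonneg_left hpow hf0]
      linarith
  -- summing the pieces
  have hsum : ((zone t X).card : ℝ) ≤
      ((parts sh t₀ X).map fun p => zmass sh θ WB WM t p + (2 * a * A + A)).sum := by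
    refine (le_trans (by exact_mod_cast card_le_card hdec) (card_lunion_le _)).trans ?_
    rw [List.map_map]
    exact sum_map_le_sum_map fun p hp => piece p hp
  rw [List.sum_map_add, sum_map_const] at hsum
  -- bookkeeping: pieces + recent mergers = whole; the piece count; the recent mergers' floor
  have hbook := zmass_parts (sh := sh) (θ := θ) (WB := WB) (WM := WM) t₀ t X
  have hlen : ((parts sh t₀ X).length : ℝ) ≤ (recN sh t₀ X : ℝ) + 1 := by exact_mod_cast length_parts_le t₀ X
  have hrec := recN_mul_le_recM (sh := sh) hθ0 hθ1 hWM0 (t₀ := t₀) (t := t) (s := s) (by omega) hchrX hft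
  have hpow : 1 / 2 ≤ θ ^ (s - 1) := hθs.trans (pow_le_pow_of_le_one hθ0 hθ1 (Nat.sub_le s 1))
  have hunit : 2 * a * A + A ≤ 2 * A := by nlinarith
  have hunit' : 2 * a * A + A ≤ WM * θ ^ (s - 1) := by
    rw [hWM]; nlinarith [mul_le_mul_of_nonneg_left hpow hA0]
  have hN0 : (0 : ℝ) ≤ recN sh t₀ X := Nat.cast_nonneg _
  have hfinal : ((parts sh t₀ X).length : ℝ) * (2 * a * A + A) ≤ recM sh θ WM t₀ t X + 2 * A := by
    have h1 : ((parts sh t₀ X).length : ℝ) * (2 * a * A + A) ≤ ((recN sh t₀ X : ℝ) + 1) * (2 * a * A + A) :=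
      mul_le_mul_of_nonneg_right hlen (by positivity)
    have h2 : (recN sh t₀ X : ℝ) * (2 * a * A + A) ≤ (recN sh t₀ X : ℝ) * (WM * θ ^ (s - 1)) :=
      mul_le_mul_of_nonneg_left hunit' hN0
    linarith
  linarith


/-- **THE LAW FOR PIECES WITH THE HALF-STRIDE ADVANCE** (`m := s∕2`, no level-advance binder). [folklore] -/
theorem card_zone_le_pieces_half (hL : 1 ≤ L) (hlv : LevelFn K lv) (hR : ZoneStepsD sh n L K lv c G zone)
    (hchr : Chrono (PEv.step ∘ sh) G) {ρ : ℕ} (hρ : 1 ≤ ρ)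
    (hlink : ∀ (t t₀ : ℕ) (X : Gen ε), X ∈ parts sh t₀ G → ftime (PEv.step ∘ sh) X ≤ t → t ≤ K →
      Linked (sideD n L K lv t) ρ (zone t X))
    {C₁ : ℝ} (hC₁ : 0 ≤ C₁)
    (hbirth : ∀ (b : ε) (j : ℕ), Sub (Gen.born b j) G →
      ((zone (sh b).step (Gen.born b j)).card : ℝ) ≤ C₁ * (((sh b).fat : ℝ) + 1))
    {s : ℕ} (hs : 1 ≤ s)
    (hsmall : (((2 * cth c 1 s + 1) ^ d : ℕ) : ℝ) * (5 : ℝ) ^ d * ρ ≤ (L : ℝ) ^ (s / 2) / 2)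
    {θ : ℝ} (hθ0 : 0 ≤ θ) (hθ1 : θ ≤ 1) (hθs : 1 / 2 ≤ θ ^ s) :
    ∀ (t tX : ℕ) (X : Gen ε), X ∈ parts sh tX G → ftime (PEv.step ∘ sh) X ≤ t → t ≤ K →
      ((zone t X).card : ℝ) ≤
        zmass sh θ (2 * (((2 * cth c 1 s + 1) ^ d : ℕ) : ℝ) * C₁)
            (4 * ((((2 * cth c 1 s + 1) ^ d : ℕ) : ℝ) * (5 : ℝ) ^ d)) t X +
          2 * ((((2 * cth c 1 s + 1) ^ d : ℕ) : ℝ) * (5 : ℝ) ^ d) :=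
  card_zone_le_pieces hL hlv hR hchr hρ hlink hC₁ hbirth hs (fun u _ => levelFn_add_half_le hlv u s) hsmall hθ0 hθ1 hθs

/-- **THE LAW FOR THE WHOLE STRUCTURE** when it is a birth or a merger (its own piece for the cut `ftime G + 1`);
a renewal's zone is its renewed structure's (`ZoneStepsD.renew`), so nothing is lost. [folklore] -/
theorem card_zone_le_pieces_self (hL : 1 ≤ L) (hlv : LevelFn K lv) (hR : ZoneStepsD sh n L K lv c G zone)
    (hchr : Chrono (PEv.step ∘ sh) G) {ρ : ℕ} (hρ : 1 ≤ ρ)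
    (hlink : ∀ (t t₀ : ℕ) (X : Gen ε), X ∈ parts sh t₀ G → ftime (PEv.step ∘ sh) X ≤ t → t ≤ K →
      Linked (sideD n L K lv t) ρ (zone t X))
    {C₁ : ℝ} (hC₁ : 0 ≤ C₁)
    (hbirth : ∀ (b : ε) (j : ℕ), Sub (Gen.born b j) G →
      ((zone (sh b).step (Gen.born b j)).card : ℝ) ≤ C₁ * (((sh b).fat : ℝ) + 1))
    {s m : ℕ} (hs : 1 ≤ s) (hm : ∀ u : ℕ, u + s ≤ K → lv u + m ≤ lv (u + s))
    (hsmall : (((2 * cth c 1 s + 1) ^ d : ℕ) : ℝ) * (5 : ℝ) ^ d * ρ ≤ (L : ℝ) ^ m / 2)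
    {θ : ℝ} (hθ0 : 0 ≤ θ) (hθ1 : θ ≤ 1) (hθs : 1 / 2 ≤ θ ^ s)
    (hG : ∀ (Y : Gen ε) (e : ε) (h : ℕ), G ≠ Gen.renew Y e h) :
    ∀ t : ℕ, ftime (PEv.step ∘ sh) G ≤ t → t ≤ K →
      ((zone t G).card : ℝ) ≤
        zmass sh θ (2 * (((2 * cth c 1 s + 1) ^ d : ℕ) : ℝ) * C₁)
            (4 * ((((2 * cth c 1 s + 1) ^ d : ℕ) : ℝ) * (5 : ℝ) ^ d)) t G +
          2 * ((((2 * cth c 1 s + 1) ^ d : ℕ) : ℝ) * (5 : ℝ) ^ d) := by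
  intro t hft htK
  have hself : G ∈ parts sh (ftime (PEv.step ∘ sh) G + 1) G := by
    cases G with
    | born b j => exact self_mem_parts_born b j _
    | renew Y e h => exact absurd rfl (hG Y e h)
    | merge A B e => exact self_mem_parts_merge A B (Nat.lt_succ_self _)
  exact card_zone_le_pieces hL hlv hR hchr hρ hlink hC₁ hbirth hs hm hsmall hθ0 hθ1 hθs t _ G hself hft htK

end Law

/-! ## §2 Sanity (decided ∕ closed instances) -/

namespace Sanity

/-- the merger (step `3`) of two births (steps `0`, `2`) is its own piece for the cut `4 = ftime + 1`, and its mass at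
`t = 3` with `θ = 1∕2`, `WB = 1`, `WM = 4` is `23∕4` (as in p212899's sanity; the law for pieces bounds THIS structure) -/
example :
    Gen.merge (Gen.born (((0, 0, 5) : PEv), 0) 0) (Gen.born (((2, 0, 1) : PEv), 1) 2) (((3, 2, 0) : PEv), 2) ∈
        parts (Prod.fst : PEv × ℕ → PEv) 4
          (Gen.merge (Gen.born (((0, 0, 5) : PEv), 0) 0) (Gen.born (((2, 0, 1) : PEv), 1) 2) (((3, 2, 0) : PEv), 2)) ∧
      zmass (Prod.fst : PEv × ℕ → PEv) (1 / 2) 1 4 3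
          (Gen.merge (Gen.born (((0, 0, 5) : PEv), 0) 0) (Gen.born (((2, 0, 1) : PEv), 1) 2) (((3, 2, 0) : PEv), 2)) =
        23 / 4 := by
  refine ⟨by decide, ?_⟩
  norm_num [zmass, PEv.fat, PEv.step]

end Sanity

end

end Summit.QuantumFields.BalabanUV.T4Continuum.HistoryZoneMassPiecesLaw
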